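/-
Copyright (c) 2026 the pub-hodgecm-mathlib formalisation cell (harness21).  Prover seat hodgecm-mathlib-K2E1-p04 (g2), Track B ∕ K2-LIT
(build stream 29), h413 = `stmt-HodgeConjecture-24833`, line `K2_E1_TraceFormulaBeta`; BY-NAME DEAL (10) of the dealer K2E1-plan (g0)
2026-09-03T23:33:31Z (`K2E1LocalIrrepAdmissibleU3`), file A: the Heisenberg-radical filtration of `U(σ, Φ₃)(K)` for Harish-Chandra's theorem.
-/
import Summits.HodgeConjecture.HodgeConjecture.Theorems.K2E1CuspidalCartanU2        -- ★ p855633: `exists_pow_valuation_mul_le`, `mem_conj_glInt_iff` (+ cone: `unipotentU`, `congruenceGL`, `glInt`)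
import HarnessLib

/-!
# K2·E1 — `K2E1CuspidalStructureU3`: the unipotent (Heisenberg) radical of `U(σ, Φ₃)(K)` — explicit shape, conjugation by `a = diag(ϖ, 1, (σϖ)⁻¹)`,
# integrality, and the ℤ-indexed filtration `N_j = a^{-j} (N ∩ GL₃(𝒪)) a^{j}`: increasing, exhausting `N`, shrinking to `1`, contracted by `a`

Track B ∕ K2-LIT, crux h413 = `stmt-HodgeConjecture-24833`, route of record `HCCMUnconditional`; cell `hodgecm-mathlib`, squad K2; prover seat
`hodgecm-mathlib-K2E1-p04` (g2), deal (10) of the dealer K2E1-plan (g0); lane `--supports stmt-HodgeConjecture-24833 --as helper` (count-neutral).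
THEOREMS ONLY (no `def`, no `instance`, no notation, no named-fact hypothesis, no `sorry`).

WHY.  ★ `Representation.isSupercuspidal_of_coinvariantsKer_eq_top_of_cartan` (generic Harish-Chandra [BernsteinZelevinsky1976 §3.18–3.21], [Casselman1995
Thm. 5.3.1]) needs, besides a Cartan-type exhaustion, a filtration `(N_j)_{j ∈ ℤ}` of subgroups exhausting the unipotent radical `N`, shrinking to `1` and
contracted by one element `a`.  For `U := U(σ, Φ₃)(K)` (`Φ₃ = antidiag(1,1,1)`, `K` a non-archimedean local field, `σ` an isometric continuous involution, `ϖ`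
a uniformiser) this file builds it — the `N = 3` twin of ★ p855684 §1: `N = {[[1,b,z],[0,1,c],[0,0,1]]} ∩ U` (Heisenberg), `a = diag(ϖ, 1, (σϖ)⁻¹) ∈ U`,
`aᵐ [[1,b,z],[0,1,c],[0,0,1]] a⁻ᵐ = [[1, ϖᵐ b, (ϖσϖ)ᵐ z],[0,1,(σϖ)ᵐ c],[0,0,1]]`, `N_j = a^{-j} (N ∩ GL₃(𝒪_K)) a^{j}`:
* §1 `coe_eq_of_mem_unipotentU₃`, `mem_unipotentU_of_coe_eq₃`, `coe_pow_diag₃`, `coe_pow_mul_mul_pow_inv₃`, `upper_mem_glInt_iff₃`, `upper_mem_congruenceGL₃`;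
* §2 **`exists_unipotent_filtration₃`**: the filtration with its four axioms (monotone, exhausting ★ `unipotentU σ J`, shrinking, contracted).
The Cartan-type exhaustion `U = ⋃ K₀ aⁿ K₀ · Z` is NOT here (★ `cartanAntidiag_of_isUnramifiedIn` at unramified places; open at ramified ones): it is the
named input of the companion `K2E1LocalIrrepAdmissibleU3`.

HONEST LABEL: HC_CM is proved only modulo the 7 printed citations (2 remaining named inputs: hLiu418 = `stmt-HodgeConjecture-24832`, h413 =
`stmt-HodgeConjecture-24833`) until rung 0 closes; this file moves no counter.
-/

set_option autoImplicit false
-- the mandated namespace repeats the single-problem summit's segment (`HodgeConjecture.HodgeConjecture`)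
set_option linter.dupNamespace false

open scoped MatrixGroups ValuativeRel Topology
open Matrix ValuativeRel Literature.NumberTheory.Automorphic Literature.NumberTheory.Automorphic.UnitaryGroup
open Summit.HodgeConjecture.HodgeConjecture.Cruxes.H413.K2E1CuspidalCartanU2 (exists_pow_valuation_mul_le mem_conj_glInt_iff)

namespace Summit.HodgeConjecture.HodgeConjecture.Cruxes.H413.K2E1CuspidalStructureU3

variable {K : Type*} [Field K] (σ : K →+* K)

/-! ## §1 The Heisenberg radical: shape, conjugation by `a = diag(ϖ, 1, (σϖ)⁻¹)`, integrality -/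

/-- An element of the unipotent radical `N` of `U(σ, Φ₃)` is `[[1,b,z],[0,1,c],[0,0,1]]` with `b, z, c` its `(0,1), (0,2), (1,2)` entries. [cite: Rogawski1990, §1.10 p. 9] -/
theorem coe_eq_of_mem_unipotentU₃ {J : Matrix (Fin 3) (Fin 3) K} {n : ↥(unitaryGroupOfForm σ J)} (hn : n ∈ unipotentU σ J) :
    ((n : GL (Fin 3) K) : Matrix (Fin 3) (Fin 3) K) =
      !![1, ((n : GL (Fin 3) K) : Matrix (Fin 3) (Fin 3) K) 0 1, ((n : GL (Fin 3) K) : Matrix (Fin 3) (Fin 3) K) 0 2;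
         0, 1, ((n : GL (Fin 3) K) : Matrix (Fin 3) (Fin 3) K) 1 2; 0, 0, 1] := by
  obtain ⟨htri, hdiag⟩ := (mem_unipotentU_iff n).1 hn
  have h10 : ((n : GL (Fin 3) K) : Matrix (Fin 3) (Fin 3) K) 1 0 = 0 := htri (by decide)
  have h20 : ((n : GL (Fin 3) K) : Matrix (Fin 3) (Fin 3) K) 2 0 = 0 := htri (by decide)
  have h21 : ((n : GL (Fin 3) K) : Matrix (Fin 3) (Fin 3) K) 2 1 = 0 := htri (by decide)
  conv_lhs => rw [Matrix.eta_fin_three ((n : GL (Fin 3) K) : Matrix (Fin 3) (Fin 3) K)]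
  rw [h10, h20, h21, hdiag 0, hdiag 1, hdiag 2]

/-- A `GL₃` element of `U(σ, J)` with matrix `[[1,b,z],[0,1,c],[0,0,1]]` belongs to the unipotent radical `N`. [cite: Rogawski1990, §1.10 p. 9] -/
theorem mem_unipotentU_of_coe_eq₃ {J : Matrix (Fin 3) (Fin 3) K} (n : ↥(unitaryGroupOfForm σ J)) {b z c : K}
    (hn : ((n : GL (Fin 3) K) : Matrix (Fin 3) (Fin 3) K) = !![1, b, z; 0, 1, c; 0, 0, 1]) : n ∈ unipotentU σ J := by
  rw [mem_unipotentU_iff, hn]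
  refine ⟨fun i j hij => ?_, fun i => ?_⟩
  · fin_cases i <;> fin_cases j <;> simp at hij ⊢
  · fin_cases i <;> simp

/-- **Powers of `a = diag(ϖ, 1, (σϖ)⁻¹)`**: `aᵐ = diag(ϖᵐ, 1, ((σϖ)⁻¹)ᵐ)`, `a⁻ᵐ = diag((ϖ⁻¹)ᵐ, 1, (σϖ)ᵐ)`. [folklore] -/
theorem coe_pow_diag₃ {ϖ : K} (a : GL (Fin 3) K) (ha : (a : Matrix (Fin 3) (Fin 3) K) = !![ϖ, 0, 0; 0, 1, 0; 0, 0, (σ ϖ)⁻¹])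
    (ha' : ((a⁻¹ : GL (Fin 3) K) : Matrix (Fin 3) (Fin 3) K) = !![ϖ⁻¹, 0, 0; 0, 1, 0; 0, 0, σ ϖ]) (m : ℕ) :
    ((a ^ m : GL (Fin 3) K) : Matrix (Fin 3) (Fin 3) K) = !![ϖ ^ m, 0, 0; 0, 1, 0; 0, 0, ((σ ϖ)⁻¹) ^ m] ∧
      (((a ^ m)⁻¹ : GL (Fin 3) K) : Matrix (Fin 3) (Fin 3) K) = !![(ϖ⁻¹) ^ m, 0, 0; 0, 1, 0; 0, 0, (σ ϖ) ^ m] := by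
  induction m with
  | zero => constructor <;> simp [Matrix.one_fin_three]
  | succ m ih =>
    constructor
    · rw [pow_succ, Units.val_mul, ih.1, ha]
      ext i j; fin_cases i <;> fin_cases j <;> simp [Matrix.mul_apply, Fin.sum_univ_three, pow_succ]
    · rw [pow_succ, _root_.mul_inv_rev, Units.val_mul, ha', ih.2]
      ext i j; fin_cases i <;> fin_cases j <;> simp [Matrix.mul_apply, Fin.sum_univ_three, pow_succ]
      all_goals ring

/-- **Conjugating a Heisenberg element by `aᵐ`**: `aᵐ [[1,b,z],[0,1,c],[0,0,1]] a⁻ᵐ = [[1, ϖᵐb, (ϖσϖ)ᵐz],[0,1,(σϖ)ᵐc],[0,0,1]]`, with inverse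
`[[1, −ϖᵐb, ϖᵐb·(σϖ)ᵐc − (ϖσϖ)ᵐz],[0,1,−(σϖ)ᵐc],[0,0,1]]`. [cite: Casselman1995, Prop. 1.4.3] -/
theorem coe_pow_mul_mul_pow_inv₃ {ϖ : K} (hϖ0 : ϖ ≠ 0) (hσϖ0 : σ ϖ ≠ 0) (a : GL (Fin 3) K)
    (ha : (a : Matrix (Fin 3) (Fin 3) K) = !![ϖ, 0, 0; 0, 1, 0; 0, 0, (σ ϖ)⁻¹])
    (ha' : ((a⁻¹ : GL (Fin 3) K) : Matrix (Fin 3) (Fin 3) K) = !![ϖ⁻¹, 0, 0; 0, 1, 0; 0, 0, σ ϖ]) {X : GL (Fin 3) K} {b z c : K}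
    (hX : (X : Matrix (Fin 3) (Fin 3) K) = !![1, b, z; 0, 1, c; 0, 0, 1]) (m : ℕ) :
    ((a ^ m * X * (a ^ m)⁻¹ : GL (Fin 3) K) : Matrix (Fin 3) (Fin 3) K) =
        !![1, ϖ ^ m * b, (ϖ * σ ϖ) ^ m * z; 0, 1, (σ ϖ) ^ m * c; 0, 0, 1] ∧
      (((a ^ m * X * (a ^ m)⁻¹)⁻¹ : GL (Fin 3) K) : Matrix (Fin 3) (Fin 3) K) =
        !![1, -(ϖ ^ m * b), ϖ ^ m * b * ((σ ϖ) ^ m * c) - (ϖ * σ ϖ) ^ m * z; 0, 1, -((σ ϖ) ^ m * c); 0, 0, 1] := by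
  obtain ⟨h1, h2⟩ := coe_pow_diag₃ σ a ha ha' m
  have hmat : ((a ^ m * X * (a ^ m)⁻¹ : GL (Fin 3) K) : Matrix (Fin 3) (Fin 3) K) =
      !![1, ϖ ^ m * b, (ϖ * σ ϖ) ^ m * z; 0, 1, (σ ϖ) ^ m * c; 0, 0, 1] := by
    rw [Units.val_mul, Units.val_mul, h1, hX, h2]
    ext i j; fin_cases i <;> fin_cases j <;> simp [Matrix.mul_apply, Fin.sum_univ_three, mul_pow, inv_pow]
    · rw [mul_inv_cancel₀ (pow_ne_zero m hϖ0)]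
    · ring
    · ring
    · rw [inv_mul_cancel₀ (pow_ne_zero m hσϖ0)]
  refine ⟨hmat, ?_⟩
  rw [Matrix.coe_units_inv, hmat]
  exact Matrix.inv_eq_right_inv (by
    ext i j; fin_cases i <;> fin_cases j <;> simp [Matrix.mul_apply, Fin.sum_univ_three]
    ring)

section Valued

variable [ValuativeRel K]

/-- **A Heisenberg matrix `[[1,B,Z],[0,1,C],[0,0,1]]` lies in `GL₃(𝒪) ⇔ B, Z, C ∈ 𝒪`** (its inverse is `[[1,−B,BC−Z],[0,1,−C],[0,0,1]]`).
[cite: CartierCorvallis1979, §IV.1] -/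
theorem upper_mem_glInt_iff₃ {X : GL (Fin 3) K} {B Z C : K} (hX : (X : Matrix (Fin 3) (Fin 3) K) = !![1, B, Z; 0, 1, C; 0, 0, 1]) :
    X ∈ glInt 3 K ↔ B ∈ 𝒪[K] ∧ Z ∈ 𝒪[K] ∧ C ∈ 𝒪[K] := by
  have hXi : ((X⁻¹ : GL (Fin 3) K) : Matrix (Fin 3) (Fin 3) K) = !![1, -B, B * C - Z; 0, 1, -C; 0, 0, 1] := by
    rw [Matrix.coe_units_inv, hX]
    exact Matrix.inv_eq_right_inv (by
      ext i j; fin_cases i <;> fin_cases j <;> simp [Matrix.mul_apply, Fin.sum_univ_three]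
      ring)
  rw [mem_glInt_iff, hX, hXi]
  constructor
  · intro h; exact ⟨by simpa using h.1 0 1, by simpa using h.1 0 2, by simpa using h.1 1 2⟩
  · rintro ⟨hB, hZ, hC⟩
    refine ⟨fun i j => ?_, fun i j => ?_⟩ <;> fin_cases i <;> fin_cases j <;>
      simp [hB, hZ, hC, one_mem, zero_mem, neg_mem hB, neg_mem hC, sub_mem (mul_mem hB hC) hZ]

/-- A Heisenberg matrix with `|B|, |Z|, |C| ≤ γ ≤ 1` lies in the principal congruence subgroup `K_γ` of `GL₃(K)`. [cite: Casselman1995, Prop. 1.4.4] -/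
theorem upper_mem_congruenceGL₃ {X : GL (Fin 3) K} {B Z C : K} (hX : (X : Matrix (Fin 3) (Fin 3) K) = !![1, B, Z; 0, 1, C; 0, 0, 1])
    {γ : ValueGroupWithZero K} (hγ : γ ≤ 1) (hB : valuation K B ≤ γ) (hZ : valuation K Z ≤ γ) (hC : valuation K C ≤ γ) :
    X ∈ congruenceGL 3 γ := by
  have hXi : ((X⁻¹ : GL (Fin 3) K) : Matrix (Fin 3) (Fin 3) K) = !![1, -B, B * C - Z; 0, 1, -C; 0, 0, 1] := by
    rw [Matrix.coe_units_inv, hX]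
    exact Matrix.inv_eq_right_inv (by
      ext i j; fin_cases i <;> fin_cases j <;> simp [Matrix.mul_apply, Fin.sum_univ_three]
      ring)
  have hBC : valuation K (B * C - Z) ≤ γ := by
    refine Valuation.map_sub_le _ ?_ hZ
    rw [map_mul]
    calc valuation K B * valuation K C ≤ γ * 1 := mul_le_mul' hB (hC.trans hγ)
      _ = γ := mul_one γ
  rw [mem_congruenceGL_iff, hX, hXi]
  refine ⟨⟨fun i j => ?_, fun i j => ?_⟩, fun i j => ?_, fun i j => ?_⟩ <;> fin_cases i <;> fin_cases j <;>
    simp [Matrix.one_fin_three, hB, hZ, hC, hB.trans hγ, hZ.trans hγ, hC.trans hγ, hBC, hBC.trans hγ, Valuation.map_neg]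

/-! ## §2 The filtration `N_j = a^{-j} (N ∩ GL₃(𝒪)) a^{j}` -/

/-- **The Heisenberg-radical filtration of `U(σ, Φ₃)(K)`** (`K` non-archimedean local, `σ` isometric, `ϖ` a uniformiser, `a = diag(ϖ, 1, (σϖ)⁻¹) ∈ U`,
any `J`): there is `Nf : ℤ → Subgroup U` — `N_j = a^{-j} (N ∩ GL₃(𝒪_K)) a^{j}` — which is INCREASING, EXHAUSTS the unipotent radical ★ `unipotentU σ J`,
SHRINKS to `1` (every neighbourhood of `1` contains some `N_j`) and is CONTRACTED by `a` (`a N_{j+1} a⁻¹ ≤ N_j`): the inputs `Nf, hmono, hexh, hsmall, hcontr`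
of ★ `Representation.isSupercuspidal_of_coinvariantsKer_eq_top_of_cartan` for `U(2,1)`. [cite: BernsteinZelevinsky1976, §3.18–3.21] [cite: Casselman1995, Prop. 1.4.3, Thm. 5.3.1] -/
theorem exists_unipotent_filtration₃ [TopologicalSpace K] [IsNonarchimedeanLocalField K] (hσ : ∀ z, σ (σ z) = z)
    (hσv : ∀ z, valuation K (σ z) = valuation K z) {J : Matrix (Fin 3) (Fin 3) K} {ϖ : K} (hϖ : IsUniformizingElement ϖ)
    (a : GL (Fin 3) K) (ha : (a : Matrix (Fin 3) (Fin 3) K) = !![ϖ, 0, 0; 0, 1, 0; 0, 0, (σ ϖ)⁻¹])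
    (ha' : ((a⁻¹ : GL (Fin 3) K) : Matrix (Fin 3) (Fin 3) K) = !![ϖ⁻¹, 0, 0; 0, 1, 0; 0, 0, σ ϖ]) (haU : a ∈ unitaryGroupOfForm σ J) :
    ∃ Nf : ℤ → Subgroup ↥(unitaryGroupOfForm σ J),
      (∀ j : ℤ, Nf j ≤ Nf (j + 1)) ∧ (∀ u ∈ unipotentU σ J, ∃ j : ℤ, u ∈ Nf j) ∧
      (∀ O ∈ 𝓝 (1 : ↥(unitaryGroupOfForm σ J)), ∃ j : ℤ, (Nf j : Set ↥(unitaryGroupOfForm σ J)) ⊆ O) ∧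
      (∀ j : ℤ, ∀ u ∈ Nf (j + 1), (⟨a, haU⟩ : ↥(unitaryGroupOfForm σ J)) * u * (⟨a, haU⟩ : ↥(unitaryGroupOfForm σ J))⁻¹ ∈ Nf j) := by
  have hϖ0 : ϖ ≠ 0 := hϖ.ne_zero
  have hσϖ0 : σ ϖ ≠ 0 := fun h => hϖ0 (by rw [← hσ ϖ, h, map_zero])
  have hvϖ : valuation K ϖ < 1 := hϖ.valuation_lt_one
  have hvσϖ : valuation K (σ ϖ) < 1 := by rw [hσv]; exact hvϖ
  have hvϖσϖ : valuation K (ϖ * σ ϖ) < 1 := by rw [map_mul]; exact mul_lt_one_of_lt_of_le hvϖ hvσϖ.le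
  obtain ⟨aU, haUdef⟩ : ∃ x : ↥(unitaryGroupOfForm σ J), x = ⟨a, haU⟩ := ⟨_, rfl⟩
  rw [← haUdef]
  obtain ⟨N₀, hN₀def⟩ : ∃ N₀ : Subgroup ↥(unitaryGroupOfForm σ J), N₀ = unipotentU σ J ⊓ (glInt 3 K).subgroupOf (unitaryGroupOfForm σ J) :=
    ⟨_, rfl⟩
  obtain ⟨Nf, hNfdef⟩ : ∃ Nf : ℤ → Subgroup ↥(unitaryGroupOfForm σ J), Nf = fun j => N₀.map (MulAut.conj (aU ^ (-j))).toMonoidHom := ⟨_, rfl⟩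
  have hmemN₀ : ∀ x : ↥(unitaryGroupOfForm σ J), x ∈ N₀ ↔ x ∈ unipotentU σ J ∧ (x : GL (Fin 3) K) ∈ glInt 3 K := by
    intro x; rw [hN₀def, Subgroup.mem_inf, Subgroup.mem_subgroupOf]
  have hmemNf : ∀ (j : ℤ) (x : ↥(unitaryGroupOfForm σ J)), x ∈ Nf j ↔ aU ^ j * x * aU ^ (-j) ∈ N₀ := by
    intro j x; rw [hNfdef]; dsimp only; rw [Subgroup.mem_map_equiv, MulAut.conj_symm_apply, _root_.zpow_neg, inv_inv]
  have hcoe_conj : ∀ (m : ℕ) (x : ↥(unitaryGroupOfForm σ J)),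
      ((aU ^ m * x * (aU ^ m)⁻¹ : ↥(unitaryGroupOfForm σ J)) : GL (Fin 3) K) = a ^ m * (x : GL (Fin 3) K) * (a ^ m)⁻¹ := by
    intro m x; rw [haUdef]; simp
  -- an element of `N₀` is a Heisenberg matrix with integral entries; conjugation by `aᵐ` scales them by `ϖᵐ, (ϖσϖ)ᵐ, (σϖ)ᵐ`
  have hN₀elt : ∀ n : ↥(unitaryGroupOfForm σ J), n ∈ N₀ →
      ((n : GL (Fin 3) K) : Matrix (Fin 3) (Fin 3) K) =
          !![1, ((n : GL (Fin 3) K) : Matrix (Fin 3) (Fin 3) K) 0 1, ((n : GL (Fin 3) K) : Matrix (Fin 3) (Fin 3) K) 0 2;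
             0, 1, ((n : GL (Fin 3) K) : Matrix (Fin 3) (Fin 3) K) 1 2; 0, 0, 1] ∧
        ((n : GL (Fin 3) K) : Matrix (Fin 3) (Fin 3) K) 0 1 ∈ 𝒪[K] ∧ ((n : GL (Fin 3) K) : Matrix (Fin 3) (Fin 3) K) 0 2 ∈ 𝒪[K] ∧
        ((n : GL (Fin 3) K) : Matrix (Fin 3) (Fin 3) K) 1 2 ∈ 𝒪[K] := by
    intro n hn
    obtain ⟨hnN, hnI⟩ := (hmemN₀ n).1 hn
    exact ⟨coe_eq_of_mem_unipotentU₃ σ hnN, (upper_mem_glInt_iff₃ (coe_eq_of_mem_unipotentU₃ σ hnN)).1 hnI⟩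
  have hconj_mem : ∀ (m : ℕ) (n : ↥(unitaryGroupOfForm σ J)) (b z c : K),
      ((n : GL (Fin 3) K) : Matrix (Fin 3) (Fin 3) K) = !![1, b, z; 0, 1, c; 0, 0, 1] →
      ϖ ^ m * b ∈ 𝒪[K] → (ϖ * σ ϖ) ^ m * z ∈ 𝒪[K] → (σ ϖ) ^ m * c ∈ 𝒪[K] → aU ^ m * n * (aU ^ m)⁻¹ ∈ N₀ := by
    intro m n b z c hnb hb hz hc
    obtain ⟨h1, -⟩ := coe_pow_mul_mul_pow_inv₃ σ hϖ0 hσϖ0 a ha ha' (X := (n : GL (Fin 3) K)) hnb m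
    rw [← hcoe_conj] at h1
    exact (hmemN₀ _).2 ⟨mem_unipotentU_of_coe_eq₃ σ _ h1, (upper_mem_glInt_iff₃ h1).2 ⟨hb, hz, hc⟩⟩
  have hint : ∀ (x : K) (t : K), valuation K t ≤ 1 → x ∈ 𝒪[K] → t * x ∈ 𝒪[K] := fun x t ht hx =>
    mul_mem ((Valuation.mem_integer_iff _ _).2 ht) hx
  -- (C) `a N₀ a⁻¹ ≤ N₀`
  have hC : ∀ n ∈ N₀, aU * n * aU⁻¹ ∈ N₀ := by
    intro n hn
    obtain ⟨hnb, hb, hz, hc⟩ := hN₀elt n hn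
    have := hconj_mem 1 n _ _ _ hnb (by rw [pow_one]; exact hint _ _ hvϖ.le hb) (by rw [pow_one]; exact hint _ _ hvϖσϖ.le hz)
      (by rw [pow_one]; exact hint _ _ hvσϖ.le hc)
    simpa using this
  refine ⟨Nf, ?_, ?_, ?_, ?_⟩
  · -- monotone
    intro j x hx
    rw [hmemNf] at hx ⊢
    have : aU ^ (j + 1) * x * aU ^ (-(j + 1)) = aU * (aU ^ j * x * aU ^ (-j)) * aU⁻¹ := by group
    rw [this]; exact hC _ hx
  · -- exhausts `N`
    intro u hu
    have hub := coe_eq_of_mem_unipotentU₃ σ hu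
    obtain ⟨m₁, hm₁⟩ := exists_pow_valuation_mul_le hvϖ (valuation K (((u : GL (Fin 3) K) : Matrix (Fin 3) (Fin 3) K) 0 1)) one_ne_zero
    obtain ⟨m₂, hm₂⟩ := exists_pow_valuation_mul_le hvϖσϖ (valuation K (((u : GL (Fin 3) K) : Matrix (Fin 3) (Fin 3) K) 0 2)) one_ne_zero
    obtain ⟨m₃, hm₃⟩ := exists_pow_valuation_mul_le hvσϖ (valuation K (((u : GL (Fin 3) K) : Matrix (Fin 3) (Fin 3) K) 1 2)) one_ne_zero
    have hanti : ∀ {x : ValueGroupWithZero K}, x < 1 → ∀ {i k : ℕ}, i ≤ k → x ^ k ≤ x ^ i := fun hx _ _ hik =>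
      pow_le_pow_right_of_le_one' hx.le hik
    refine ⟨(m₁ + m₂ + m₃ : ℕ), (hmemNf _ u).2 ?_⟩
    rw [_root_.zpow_neg, zpow_natCast]
    refine hconj_mem (m₁ + m₂ + m₃) u _ _ _ hub ?_ ?_ ?_
    · rw [Valuation.mem_integer_iff, map_mul, map_pow]
      exact le_trans (mul_le_mul_of_nonneg_right (hanti hvϖ (by omega)) zero_le) hm₁
    · rw [Valuation.mem_integer_iff, map_mul, map_pow]
      exact le_trans (mul_le_mul_of_nonneg_right (hanti hvϖσϖ (by omega)) zero_le) hm₂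
    · rw [Valuation.mem_integer_iff, map_mul, map_pow]
      exact le_trans (mul_le_mul_of_nonneg_right (hanti hvσϖ (by omega)) zero_le) hm₃
  · -- shrinks to `1`
    intro O hO
    obtain ⟨O', hO', hO'sub⟩ := (mem_nhds_induced Subtype.val (1 : ↥(unitaryGroupOfForm σ J)) O).1 hO
    obtain ⟨m, -, hm₀⟩ := exists_congruenceGL_pow_subset (n := 3) hϖ hO'
    refine ⟨-(m : ℤ), fun x hx => ?_⟩
    have hx' : aU ^ (-(m : ℤ)) * x * aU ^ (m : ℤ) ∈ N₀ := by
      have := (hmemNf (-(m : ℤ)) x).1 hx; rwa [neg_neg] at this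
    obtain ⟨hnb, hb, hz, hc⟩ := hN₀elt _ hx'
    obtain ⟨b, hbdef⟩ : ∃ b : K, b = (((aU ^ (-(m : ℤ)) * x * aU ^ (m : ℤ) : ↥(unitaryGroupOfForm σ J)) : GL (Fin 3) K) :
        Matrix (Fin 3) (Fin 3) K) 0 1 := ⟨_, rfl⟩
    obtain ⟨z, hzdef⟩ : ∃ z : K, z = (((aU ^ (-(m : ℤ)) * x * aU ^ (m : ℤ) : ↥(unitaryGroupOfForm σ J)) : GL (Fin 3) K) :
        Matrix (Fin 3) (Fin 3) K) 0 2 := ⟨_, rfl⟩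
    obtain ⟨c, hcdef⟩ : ∃ c : K, c = (((aU ^ (-(m : ℤ)) * x * aU ^ (m : ℤ) : ↥(unitaryGroupOfForm σ J)) : GL (Fin 3) K) :
        Matrix (Fin 3) (Fin 3) K) 1 2 := ⟨_, rfl⟩
    rw [← hbdef, ← hzdef, ← hcdef] at hnb
    rw [← hbdef] at hb; rw [← hzdef] at hz; rw [← hcdef] at hc
    have hxeq : x = aU ^ m * (aU ^ (-(m : ℤ)) * x * aU ^ (m : ℤ)) * (aU ^ m)⁻¹ := by
      rw [← zpow_natCast]; group
    obtain ⟨h1, -⟩ := coe_pow_mul_mul_pow_inv₃ σ hϖ0 hσϖ0 a ha ha' hnb m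
    rw [← hcoe_conj, ← hxeq] at h1
    apply hO'sub
    rw [Set.mem_preimage]
    apply hm₀
    have hle : ∀ {t y : K}, valuation K t < 1 → y ∈ 𝒪[K] → valuation K (t ^ m * y) ≤ valuation K ϖ ^ m → True := fun _ _ _ => trivial
    have hb' : valuation K (ϖ ^ m * b) ≤ valuation K ϖ ^ m := by
      rw [map_mul, map_pow]
      calc valuation K ϖ ^ m * valuation K b ≤ valuation K ϖ ^ m * 1 :=
            mul_le_mul_of_nonneg_left ((Valuation.mem_integer_iff _ _).1 hb) zero_le
        _ = valuation K ϖ ^ m := mul_one _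
    have hz' : valuation K ((ϖ * σ ϖ) ^ m * z) ≤ valuation K ϖ ^ m := by
      rw [map_mul, map_pow, map_mul, hσv]
      calc (valuation K ϖ * valuation K ϖ) ^ m * valuation K z ≤ valuation K ϖ ^ m * 1 :=
            mul_le_mul' (pow_le_pow_left₀ zero_le (mul_le_of_le_one_right zero_le hvϖ.le) m) ((Valuation.mem_integer_iff _ _).1 hz)
        _ = valuation K ϖ ^ m := mul_one _
    have hc' : valuation K ((σ ϖ) ^ m * c) ≤ valuation K ϖ ^ m := by
      rw [map_mul, map_pow, hσv]
      calc valuation K ϖ ^ m * valuation K c ≤ valuation K ϖ ^ m * 1 :=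
            mul_le_mul_of_nonneg_left ((Valuation.mem_integer_iff _ _).1 hc) zero_le
        _ = valuation K ϖ ^ m := mul_one _
    exact upper_mem_congruenceGL₃ h1 (pow_le_one₀ zero_le hvϖ.le) hb' hz' hc'
  · -- contracted by `a`
    intro j u hu
    rw [hmemNf] at hu ⊢
    have : aU ^ j * (aU * u * aU⁻¹) * aU ^ (-j) = aU ^ (j + 1) * u * aU ^ (-(j + 1)) := by group
    rw [this]; exact hu

end Valued

end Summit.HodgeConjecture.HodgeConjecture.Cruxes.H413.K2E1CuspidalStructureU3
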